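import Mathlib.Combinatorics.SetFamily.FourFunctions
import Mathlib.Tactic
import HarnessLib
import HarnessLib.Audit.Tags

/-!
# `NoHeavyLowerTail` (crux stmt-CriticalPhenomena-4575), master-family line P1 (gen 28):
# the STRONG DAYKIN conjecture (coloured Ahlswede–Daykin) — typed, with its `k = 2` case

Support file (seat `prim-masterthm-p1`, gen 28; `--supports stmt-CriticalPhenomena-4575`).  Two definitions (`crossSups`, `crossInfs`) and one
typed conjecture, no `sorry`, standard axioms.  Memo `run/shared/lean/prim/prim-masterthm/FROM-prim-masterthm-p1-g28-STRONG-DAYKIN.md`.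

**CONJECTURE (strong Daykin / coloured Ahlswede–Daykin, `StrongDaykin`) [this work].**  For PAIRWISE DISJOINT families `A_1, …, A_k` of finite sets:
  `Σ_{i<j} |A_i||A_j| ≤ |⋃_{i≠j} A_i ∨ A_j| · |⋃_{i≠j} A_i ∧ A_j|`   (bichromatic pairs ≤ bichromatic unions × bichromatic intersections).
* `k = 2` is Daykin's inequality (`strongDaykin_two`, from Mathlib `Finset.le_card_infs_mul_card_sups`; no disjointness needed).
* All classes singletons is the distinct-pairs Ahlswede–Daykin THEOREM of `…SahiStrongDaykin` (`card_choose_two_le`, gen 28).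
* The weighted form for a product measure and three PETAL families is exactly gen 26's `G_JM(3)` (`e₂ ≤ μ(J₂)·μ(M₂)`), for `k` petals `G_JM(k)`;
  it implies Gladkov's strong Harris inequality `e₂(μ(C_i)) ≤ μ(K)·μ(O)` [Gladkov2024, Thm. 2.1] since cross joins of petals lie in the kernel
  and cross meets in the outside; its sub-cube (comb) form for `k = 3` follows from gen 27's `SignedColouredDaykin3`.
* EVIDENCE (memo §2): exhaustive on `2^≤3` for `k ≤ 4` colours (counting), 0 failures in `> 10⁵` hill-climbing descents on `2^4 … 2^6` for the
  counting, product-measure and random log-supermodular (FKG) weights, minimum ratio exactly `1`; the inequality is false for arbitrary positive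
  weights, false for non-disjoint classes, and false for "graph" versions whose compatibility graph is not complete multipartite (path `P₄`
  on four singletons: `{∅}–{12}–{1}–{2}` in `2^2` has 3 edges but `|J||M| = 1·2`).  The two Daykin–Lovász-style polarisations are false (memo §3).
HONEST FRAMING: a typed conjecture and its classical `k = 2` case; `k ≥ 3` with a non-singleton class is OPEN. [this work]
-/

namespace Summit.CriticalPhenomena.PercolationContinuityZ3.Theorems.SahiStrongDaykin

open Finset
open scoped FinsetFamily

variable {α : Type*} [DecidableEq α]

/-! ### The strong Daykin conjecture (coloured classes) -/

/-- Bichromatic unions of an indexed family of classes: `⋃_{i ≠ j} A_i ∨ A_j`. [this work] -/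
def crossSups {ι : Type*} [Fintype ι] [DecidableEq ι] (A : ι → Finset (Finset α)) : Finset (Finset α) :=
  ((univ : Finset (ι × ι)).filter fun ij => ij.1 ≠ ij.2).biUnion fun ij => A ij.1 ⊻ A ij.2

/-- Bichromatic intersections: `⋃_{i ≠ j} A_i ∧ A_j`. [this work] -/
def crossInfs {ι : Type*} [Fintype ι] [DecidableEq ι] (A : ι → Finset (Finset α)) : Finset (Finset α) :=
  ((univ : Finset (ι × ι)).filter fun ij => ij.1 ≠ ij.2).biUnion fun ij => A ij.1 ⊼ A ij.2

/-- Membership in `crossSups`. [this work] -/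
theorem sup_mem_crossSups {ι : Type*} [Fintype ι] [DecidableEq ι] {A : ι → Finset (Finset α)} {i j : ι} (hij : i ≠ j)
    {s t : Finset α} (hs : s ∈ A i) (ht : t ∈ A j) : s ∪ t ∈ crossSups A :=
  mem_biUnion.2 ⟨(i, j), mem_filter.2 ⟨mem_univ _, hij⟩, mem_sups.2 ⟨s, hs, t, ht, rfl⟩⟩

/-- Membership in `crossInfs`. [this work] -/
theorem inf_mem_crossInfs {ι : Type*} [Fintype ι] [DecidableEq ι] {A : ι → Finset (Finset α)} {i j : ι} (hij : i ≠ j)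
    {s t : Finset α} (hs : s ∈ A i) (ht : t ∈ A j) : s ∩ t ∈ crossInfs A :=
  mem_biUnion.2 ⟨(i, j), mem_filter.2 ⟨mem_univ _, hij⟩, mem_infs.2 ⟨s, hs, t, ht, rfl⟩⟩

/-- **CONJECTURE (strong Daykin / coloured Ahlswede–Daykin; typed, counting form).**  For `k` pairwise disjoint families of
finite sets, the number of bichromatic pairs is at most (bichromatic intersections) × (bichromatic unions):
`Σ_{i<j} |A_i||A_j| ≤ |crossInfs A| · |crossSups A|` (here with ordered pairs and a factor `2`).  `k = 2`: Daykin
(`strongDaykin_two`); all classes singletons: `card_choose_two_le`; three petal families under a product measure: gen 26's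
`G_JM(3)`.  Exhaustive on `2^≤3` (`k ≤ 4`), `10⁵` adversarial descents on `2^4…2^6` clean (memo §2). [this work] [status: open] -/
@[conjecture] def StrongDaykin (α : Type*) [DecidableEq α] (k : ℕ) : Prop :=
  ∀ A : Fin k → Finset (Finset α), (∀ i j, i ≠ j → Disjoint (A i) (A j)) →
    ∑ ij ∈ (univ : Finset (Fin k × Fin k)).filter (fun ij => ij.1 ≠ ij.2), #(A ij.1) * #(A ij.2)
      ≤ 2 * (#(crossInfs A) * #(crossSups A))

/-- **`k = 2` is Daykin's inequality** (no disjointness needed). [this work] -/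
theorem strongDaykin_two : StrongDaykin α 2 := by
  intro A _
  have hpairs : (univ : Finset (Fin 2 × Fin 2)).filter (fun ij => ij.1 ≠ ij.2) = {((0 : Fin 2), (1 : Fin 2)), (1, 0)} := by
    decide
  rw [hpairs, sum_pair (by decide)]
  have h01 : (0 : Fin 2) ≠ 1 := by decide
  have hD := Finset.le_card_infs_mul_card_sups (A 0) (A 1)
  have hI : #(A 0 ⊼ A 1) ≤ #(crossInfs A) :=
    card_le_card fun x hx => by
      obtain ⟨s, hs, t, ht, rfl⟩ := mem_infs.1 hx
      exact inf_mem_crossInfs h01 hs ht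
  have hS : #(A 0 ⊻ A 1) ≤ #(crossSups A) :=
    card_le_card fun x hx => by
      obtain ⟨s, hs, t, ht, rfl⟩ := mem_sups.1 hx
      exact sup_mem_crossSups h01 hs ht
  have := Nat.mul_le_mul hI hS
  simp only
  nlinarith [mul_comm #(A 0) #(A 1)]

/-- **CONJECTURE (strong Daykin, WEIGHTED form; typed).**  For a nonnegative weight `w` log-supermodular on `2^u` and pairwise disjoint
`A_1, …, A_k ⊆ 2^u`: `Σ_{i≠j} w(A_i)·w(A_j) ≤ 2·w(crossInfs A)·w(crossSups A)`.  For the Bernoulli product weight and three PETAL families of a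
sunflower system this is gen 26's `G_JM(3)` (`e₂ ≤ μ(J₂)μ(M₂)`); it implies Gladkov's `e₂(μ(C_i)) ≤ μ(K)μ(O)` [Gladkov2024, Thm. 2.1/3.2].
`k = 2`: the four functions theorem (`strongDaykinLogSupermodular_two`); all classes singletons: `…SahiStrongDaykin.sq_sum_le_of_logSupermodular`.
0 failures on random product and random FKG weights, `2^3 … 2^6` (memo §2). [this work] [status: open] -/
@[conjecture] def StrongDaykinLogSupermodular (α : Type*) [DecidableEq α] (k : ℕ) : Prop :=
  ∀ (u : Finset α) (w : Finset α → ℝ) (A : Fin k → Finset (Finset α)), (∀ s, 0 ≤ w s) →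
    (∀ s ⊆ u, ∀ t ⊆ u, w s * w t ≤ w (s ∩ t) * w (s ∪ t)) → (∀ i, A i ⊆ u.powerset) →
    (∀ i j, i ≠ j → Disjoint (A i) (A j)) →
    ∑ ij ∈ (univ : Finset (Fin k × Fin k)).filter (fun ij => ij.1 ≠ ij.2), (∑ s ∈ A ij.1, w s) * ∑ s ∈ A ij.2, w s
      ≤ 2 * ((∑ s ∈ crossInfs A, w s) * ∑ s ∈ crossSups A, w s)

/-- **`k = 2`, weighted: the four functions theorem** (no disjointness needed). [this work] -/
theorem strongDaykinLogSupermodular_two : StrongDaykinLogSupermodular α 2 := by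
  intro u w A hw hmod hA _
  have hpairs : (univ : Finset (Fin 2 × Fin 2)).filter (fun ij => ij.1 ≠ ij.2) = {((0 : Fin 2), (1 : Fin 2)), (1, 0)} := by
    decide
  rw [hpairs, sum_pair (by decide)]
  have h01 : (0 : Fin 2) ≠ 1 := by decide
  have hD : (∑ s ∈ A 0, w s) * ∑ s ∈ A 1, w s ≤ (∑ s ∈ A 0 ⊼ A 1, w s) * ∑ s ∈ A 0 ⊻ A 1, w s :=
    Finset.four_functions_theorem u (fun s => hw s) (fun s => hw s) (fun s => hw s) (fun s => hw s)
      (fun s hs t ht => hmod s hs t ht) (hA 0) (hA 1)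
  have hI : ∑ s ∈ A 0 ⊼ A 1, w s ≤ ∑ s ∈ crossInfs A, w s :=
    sum_le_sum_of_subset_of_nonneg (fun x hx => by
      obtain ⟨s, hs, t, ht, rfl⟩ := mem_infs.1 hx
      exact inf_mem_crossInfs h01 hs ht) fun s _ _ => hw s
  have hS : ∑ s ∈ A 0 ⊻ A 1, w s ≤ ∑ s ∈ crossSups A, w s :=
    sum_le_sum_of_subset_of_nonneg (fun x hx => by
      obtain ⟨s, hs, t, ht, rfl⟩ := mem_sups.1 hx
      exact sup_mem_crossSups h01 hs ht) fun s _ _ => hw s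
  have n0 : 0 ≤ ∑ s ∈ A 0, w s := sum_nonneg fun s _ => hw s
  have n1 : 0 ≤ ∑ s ∈ A 1, w s := sum_nonneg fun s _ => hw s
  have n2 : 0 ≤ ∑ s ∈ A 0 ⊼ A 1, w s := sum_nonneg fun s _ => hw s
  have n3 : 0 ≤ ∑ s ∈ crossSups A, w s := sum_nonneg fun s _ => hw s
  have := mul_le_mul hI hS (sum_nonneg fun s _ => hw s) (n2.trans hI)
  simp only
  nlinarith [mul_comm (∑ s ∈ A 0, w s) (∑ s ∈ A 1, w s)]

end Summit.CriticalPhenomena.PercolationContinuityZ3.Theorems.SahiStrongDaykin
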